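import Summits.CriticalPhenomena.Ising3D.Control2DOpeEpsTailSharp
import Summits.CriticalPhenomena.Ising3D.Control2DOpeEpsKernel
import Summits.CriticalPhenomena.Ising3D.Control2DOpeEpsCells
import Mathlib.Tactic.Linarith
import Mathlib.Tactic.Positivity
import Mathlib.Tactic.FieldSimp
import Mathlib.Tactic.Ring
import Mathlib.Tactic.LinearCombination
import HarnessLib

/-!
# Kind `ope2eps`, sense LOWER with the SHARP tail: the cells consumer and the kernel sign leaf
(cell `pub-ising3x`, seat controls-1 gen 21; KERNEL PATH for the 2D γ-certificates, kind `ope2eps` — CONTROL-ONLY)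

HONEST FRAMING: lottery ticket; floor = tightest certified 3D Ising CFT bounds; no exact-solution
claim without a proof. CONTROL-ONLY (`d = 2`, axiom set `A2D′`); nothing numerical is asserted here.

The twin of `Control2DOpeEpsCells.opeEpsLower_half_of_cellsN` / `Control2DOpeEpsKernel.epsSignLower_of_bernAuto_trunc` with the sharp
majorant `phi_block0_le_QN_add_tail_sharp` of `Control2DOpeEpsTailSharp` (`σ = tailMajorB Λ N`, `S_N = headMajorB Λ N`, hypothesis
`2Λ < N + 2` instead of `Λ < N + 3`): `opeEpsLower_half_of_cellsN_sharp`; the kernel's integers `bndBK` (= `bndB`, by structural recursion,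
binomials through `descFactorial / i!`), `headMajorBK` (`headMajorB Λ N = headMajorBK Λ N N / 2^N`), `epsAB = 2(N+2-Λ)·B(N+1,Λ)`
(`σ = A/(2^N d)`, `d = N+2-2Λ`), `epsC1B = 4^N d²`, the tail constant `epsKZB = 8^Λ Λ!² 4^{Nd}·2·A(2Hd+A)·W`, the sign polynomial
`epsLowerPolyZB = -(c₁ P̂₀ + K D₀²)`, the margin `epsLowerMarginB` and **`epsSignLowerB_of_bernAuto_trunc`**: one `bernAuto` decision per box cell
gives the sign check of `opeEpsLower_half_of_cellsN_sharp` with the margin at the cell's right end. PROVED; no facts, standard axioms only.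
[cite: RattazziEtAl2008, §5]
-/

namespace Summit.CriticalPhenomena.Ising3D.Control2D

open Finset Set
open Literature.Analysis.ValidatedNumerics.PolyMP
open Literature.MathematicalPhysics.QuantumFieldTheory.ConformalBootstrap3D

/-! ### The cells consumer with the sharp majorant -/

/-- **Kind `ope2eps`, sense LOWER, at `(1/2,1/2)` from the cells record, SHARP tail** (as `opeEpsLower_half_of_cellsN` with
`2Λ < N + 2` and the sign check `2^Δ φ[F_-[Q_N(Δ,0)]] + (1/2)^{2s}·2W·σ(2S_N+σ) ≤ -σ₀`, `σ = tailMajorB Λ N`, `S_N = headMajorB Λ N`).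
[cite: RattazziEtAl2008, §5] -/
theorem opeEpsLower_half_of_cellsN_sharp (S : Finset (ℕ × ℕ)) (w : ℕ × ℕ → ℝ) {s G δ e₁ e₂ P E₀ σ : ℝ} {Λ N : ℕ}
    (hs0 : 0 ≤ s) (hs1 : s < 1) (he : 2 * s < e₁) (hG : 2 * s < G) (he12 : e₁ ≤ e₂) (he2 : e₂ ≤ 2)
    (hδ : 0 ≤ δ) (hP : 0 < P) (hσ : 0 < σ) (hΛ : ∀ p ∈ S, p.1 ≤ Λ ∧ p.2 ≤ Λ) (hNE : E₀ ≤ e₁ + N) (hNΛ : 2 * Λ < N + 2)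
    (hbox : ∀ Δ : ℝ, e₁ ≤ Δ → Δ ≤ e₂ →
      (2 : ℝ) ^ Δ * taylorFunctional2D (1 / 2) S w (crossF s (-1) (QN N 0 Δ)) +
          (1 / 2 : ℝ) ^ s * (1 / 2 : ℝ) ^ s * (2 * absWeight S w) *
            (tailMajorB Λ N * (2 * headMajorB Λ N + tailMajorB Λ N)) ≤ -σ ∧
      0 < taylorFunctional2D (1 / 2) S w (crossF s (-1) (fun _ _ => (1 : ℝ))) +
        P * ((2 : ℝ) ^ Δ * taylorFunctional2D (1 / 2) S w (crossF s (-1) (QN N 0 Δ))))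
    (hR : ∀ (b : ℝ) (J : ℕ), 0 ≤ b → E₀ ≤ 2 * b + J →
      0 ≤ ∑ p ∈ S, w p * ((1 - (-1 : ℝ) ^ (p.1 + p.2)) * 2 ^ (p.1 + p.2) *
        (qFactor₁ s (b + J) p.1 * qFactor₁ s b p.2 + qFactor₁ s b p.1 * qFactor₁ s (b + J) p.2)))
    (hc : OpeEpsCellsN S w s G δ E₀) : OpeEpsLowerA2D s G δ e₁ e₂ P := by
  have hφ := isTaylorFunctional_taylorFunctional2D (1 / 2) S w
  have hx0 : (0 : ℝ) < 1 / 2 := by norm_num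
  have hx1 : (1 / 2 : ℝ) < 1 := by norm_num
  have hpair : PairPositiveAbove (taylorFunctional2D (1 / 2) S w) s E₀ := pairPositiveAbove_half_of_poly S w hR
  set T : ℝ := (1 / 2 : ℝ) ^ s * (1 / 2 : ℝ) ^ s * (2 * absWeight S w) *
    (tailMajorB Λ N * (2 * headMajorB Λ N + tailMajorB Λ N)) with hT
  have hlift : ∀ Δ : ℝ, e₁ ≤ Δ → Δ ≤ e₂ →
      (2 : ℝ) ^ Δ * taylorFunctional2D (1 / 2) S w (crossF s (-1) (globalBlock Δ 0)) ≤ -σ ∧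
      0 < taylorFunctional2D (1 / 2) S w (crossF s (-1) (fun _ _ => (1 : ℝ))) +
        P * ((2 : ℝ) ^ Δ * taylorFunctional2D (1 / 2) S w (crossF s (-1) (globalBlock Δ 0))) := by
    intro Δ h1 h2
    obtain ⟨hX, hIQ⟩ := hbox Δ h1 h2
    have hΔ0 : 0 ≤ Δ := by linarith
    have hle := phi_QN_le_block_taylor hφ hx0 hx1 hpair (Δ := Δ) (ℓ := 0) (N := N)
      (by simp only [Nat.cast_zero]; linarith) (by linarith)
    have hup := phi_block0_le_QN_add_tail_sharp S w hs0 hs1.le hΛ hΔ0 (by linarith) hNΛ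
    have h2Δ : (0 : ℝ) < (2 : ℝ) ^ Δ := Real.rpow_pos_of_pos (by norm_num) _
    have hone : (2 : ℝ) ^ Δ * (1 / 2 : ℝ) ^ Δ = 1 := by
      rw [← Real.mul_rpow (by norm_num) (by norm_num)]; norm_num
    constructor
    · have hmul := mul_le_mul_of_nonneg_left hup h2Δ.le
      have hexp : (2 : ℝ) ^ Δ * (taylorFunctional2D (1 / 2) S w (crossF s (-1) (QN N 0 Δ)) +
          (1 / 2 : ℝ) ^ s * (1 / 2 : ℝ) ^ s * (1 / 2 : ℝ) ^ Δ * (2 * absWeight S w) *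
            (tailMajorB Λ N * (2 * headMajorB Λ N + tailMajorB Λ N))) =
          (2 : ℝ) ^ Δ * taylorFunctional2D (1 / 2) S w (crossF s (-1) (QN N 0 Δ)) + ((2 : ℝ) ^ Δ * (1 / 2 : ℝ) ^ Δ) * T := by
        rw [hT]; ring
      rw [hexp, hone, one_mul] at hmul
      linarith
    · have : P * ((2 : ℝ) ^ Δ * taylorFunctional2D (1 / 2) S w (crossF s (-1) (QN N 0 Δ))) ≤
          P * ((2 : ℝ) ^ Δ * taylorFunctional2D (1 / 2) S w (crossF s (-1) (globalBlock Δ 0))) :=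
        mul_le_mul_of_nonneg_left (mul_le_mul_of_nonneg_left hle h2Δ.le) hP.le
      linarith
  have hob := opeEpsObligations_half_of_cellsN S w hG hδ (fun Δ h1 h2 => (hlift Δ h1 h2).2) hR hc hs0
  exact OpeEpsA2DObligations.opeEpsLower_taylor hφ hx0 hx1 he hG hs1 hob hP he12 hσ fun Δ h1 h2 => (hlift Δ h1 h2).1

/-! ### The kernel's integers -/

/-- Kernel-friendly `bndC` (the binomial through `descFactorial / i!`). [folklore] -/
def bndCK (n i : ℕ) : ℕ := if i ≤ n then n.descFactorial i / i.factorial else 1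

/-- [folklore] -/
theorem bndCK_eq (n i : ℕ) : bndCK n i = bndC n i := by
  unfold bndCK bndC
  split_ifs
  · rw [Nat.choose_eq_descFactorial_div_factorial]
  · rfl

/-- `B(n,k)` by structural recursion on `k`. [folklore] -/
def bndBK (n : ℕ) : ℕ → ℕ
  | 0 => bndCK n 0
  | k + 1 => bndBK n k + bndCK n (k + 1)

/-- [folklore] -/
theorem bndBK_eq (n : ℕ) : ∀ k : ℕ, bndBK n k = bndB n k
  | 0 => by simp [bndBK, bndB, bndCK_eq]
  | k + 1 => by
      rw [bndBK, bndBK_eq n k]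
      simp only [bndB, Finset.sum_range_succ, bndCK_eq]

/-- `H^B = Σ_{m<N} 2^{N-m} B(m+1,Λ)` (so `headMajorB Λ N = H^B / 2^N`). [folklore] -/
def headMajorBZ (Λ N : ℕ) : ℕ := ∑ m ∈ range N, 2 ^ (N - m) * bndB (m + 1) Λ

/-- [folklore] -/
theorem headMajorB_eq (Λ N : ℕ) : headMajorB Λ N = (headMajorBZ Λ N : ℝ) / 2 ^ N := by
  rw [headMajorB, headMajorBZ, Nat.cast_sum, Finset.sum_div]
  refine Finset.sum_congr rfl fun m hm => ?_
  have hmN : m ≤ N := (Finset.mem_range.mp hm).le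
  push_cast
  rw [one_div_pow, show (2 : ℝ) ^ N = 2 ^ (N - m) * 2 ^ m by rw [← pow_add, Nat.sub_add_cancel hmN]]
  field_simp

/-- The kernel's `H^B` by structural recursion. [folklore] -/
def headMajorBK (Λ N : ℕ) : ℕ → ℕ
  | 0 => 0
  | k + 1 => headMajorBK Λ N k + 2 ^ (N - k) * bndBK (k + 1) Λ

/-- [folklore] -/
theorem headMajorBK_eq (Λ N : ℕ) : ∀ k : ℕ, headMajorBK Λ N k = ∑ m ∈ range k, 2 ^ (N - m) * bndB (m + 1) Λ
  | 0 => by simp [headMajorBK]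
  | k + 1 => by rw [headMajorBK, headMajorBK_eq Λ N k, sum_range_succ, bndBK_eq]

/-- `A = 2(N+2-Λ)·B(N+1,Λ)` (`N = Nd+1`; `σ = A/(2^N d)`, `d = N+2-2Λ`). [folklore] -/
def epsAB (Λ Nd : ℕ) : ℕ := 2 * (Nd + 1 + 2 - Λ) * bndBK (Nd + 1 + 1) Λ

/-- `c₁ = 4^N d²`, `d = N+2-2Λ`. [folklore] -/
def epsC1B (Λ Nd : ℕ) : ℕ := 4 ^ (Nd + 1) * (Nd + 1 + 2 - 2 * Λ) ^ 2

/-- The integer tail constant `K = 8^Λ Λ!² 4^{Nd} · 2 · A (2Hd + A) · W` of the sharp majorant. [folklore] -/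
def epsKZB (wt : ℕ × ℕ → ℤ) (Sl : List (ℕ × ℕ)) (Λ Nd : ℕ) : ℤ :=
  ((8 ^ Λ * Λ.factorial * Λ.factorial * 4 ^ Nd * 2 *
      (epsAB Λ Nd * (2 * headMajorBK Λ (Nd + 1) (Nd + 1) * (Nd + 1 + 2 - 2 * Λ) + epsAB Λ Nd)) : ℕ) : ℤ) * wabsZ wt Sl

/-- The LOWER sign polynomial `-(c₁ P̂₀ + K D₀²)` with the sharp tail constant. [folklore] -/
def epsLowerPolyZB (wt : ℕ × ℕ → ℤ) (Sl : List (ℕ × ℕ)) (Λ Nd : ℕ) : List ℤ :=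
  zadd (zsmul (-((epsC1B Λ Nd : ℕ) : ℤ)) (cellPolyZ wt Sl Λ 0 Nd)) (zsmul (-(epsKZB wt Sl Λ Nd)) (zmul (dpolyZ Nd) (dpolyZ Nd)))

/-- The uniform margin of the sharp LOWER sign leaf on a cell with right end `y₂`. [folklore] -/
noncomputable def epsLowerMarginB (Λ Nd : ℕ) (y₂ : ℝ) : ℝ :=
  (1 / 2 : ℝ) ^ (1 / 8 : ℝ) * (1 / 2 : ℝ) ^ (1 / 8 : ℝ) /
    (8 ^ Λ * (Λ.factorial : ℝ) * (Λ.factorial : ℝ) * (4 : ℝ) ^ Nd * ((epsC1B Λ Nd : ℕ) : ℝ) * (denProd Nd 0 y₂) ^ 2)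

/-- [folklore] -/
theorem epsC1B_pos {Λ Nd : ℕ} (hΛ : 2 * Λ < Nd + 3) : 0 < epsC1B Λ Nd := by
  unfold epsC1B
  have : 0 < Nd + 1 + 2 - 2 * Λ := by omega
  positivity

/-- [folklore] -/
theorem epsLowerMarginB_pos (Λ Nd : ℕ) {y₂ : ℝ} (hy : 0 ≤ y₂) (hΛ : 2 * Λ < Nd + 3) : 0 < epsLowerMarginB Λ Nd y₂ := by
  unfold epsLowerMarginB
  have hc2 : (0 : ℝ) < (1 / 2 : ℝ) ^ (1 / 8 : ℝ) := Real.rpow_pos_of_pos (by norm_num) _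
  have hD : 0 < denProd Nd 0 y₂ := denProd_pos Nd 0 (by push_cast; linarith)
  have hd : (0 : ℝ) < ((epsC1B Λ Nd : ℕ) : ℝ) := by exact_mod_cast epsC1B_pos hΛ
  positivity

/-- The margin is antitone in the right end. [folklore] -/
theorem epsLowerMarginB_anti (Λ Nd : ℕ) {y y' : ℝ} (hy : 0 ≤ y) (hyy : y ≤ y') (hΛ : 2 * Λ < Nd + 3) :
    epsLowerMarginB Λ Nd y' ≤ epsLowerMarginB Λ Nd y := by
  unfold epsLowerMarginB
  have hc2 : (0 : ℝ) < (1 / 2 : ℝ) ^ (1 / 8 : ℝ) := Real.rpow_pos_of_pos (by norm_num) _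
  have hD : 0 < denProd Nd 0 y := denProd_pos Nd 0 (by push_cast; linarith)
  have hDm : denProd Nd 0 y ≤ denProd Nd 0 y' := denProd_zero_mono Nd hy hyy
  have hd : (0 : ℝ) < ((epsC1B Λ Nd : ℕ) : ℝ) := by exact_mod_cast epsC1B_pos hΛ
  have hsq : (denProd Nd 0 y) ^ 2 ≤ (denProd Nd 0 y') ^ 2 := pow_le_pow_left₀ hD.le hDm 2
  exact div_le_div_of_nonneg_left (by positivity) (by positivity) (mul_le_mul_of_nonneg_left hsq (by positivity))

set_option maxHeartbeats 800000 in
/-- **LOWER sign leaf with the SHARP integer tail**: `bernAuto (ptrunc (epsLowerPolyZB - 1) m) q a L = true` (`q > 0`, `a ≥ 0`, `L ≥ 0`,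
`2Λ < Nd + 3`) gives, for every `Δ` with `2a/q ≤ Δ ≤ 2(a+L)/q`, the sign check of `opeEpsLower_half_of_cellsN_sharp` with the margin at the
cell's right end: `2^Δ φ[F_-[Q_{Nd+1}(Δ,0)]] + (1/2)^{1/8}(1/2)^{1/8}·2W·σ(2S_N+σ) ≤ -epsLowerMarginB Λ Nd ((a+L)/q)`,
`N = Nd + 1`, `σ = tailMajorB Λ N`, `S_N = headMajorB Λ N`. [folklore] -/
theorem epsSignLowerB_of_bernAuto_trunc (wt : ℕ × ℕ → ℤ) {Sl : List (ℕ × ℕ)} (hnd : Sl.Nodup) {Λ : ℕ}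
    (hΛ : ∀ p ∈ Sl, p.1 + p.2 ≤ Λ) (Nd m : ℕ) (hΛN : 2 * Λ < Nd + 3) {q a L : ℤ} (hq : 0 < q) (ha : 0 ≤ a) (hL : 0 ≤ L)
    (hchk : bernAuto (ptrunc (zadd (epsLowerPolyZB wt Sl Λ Nd) [-1]) m) q a L = true) {Δ : ℝ}
    (hlo : 2 * (a : ℝ) / q ≤ Δ) (hhi : Δ ≤ 2 * ((a : ℝ) + L) / q) :
    (2 : ℝ) ^ Δ * taylorFunctional2D (1 / 2) Sl.toFinset (fun p => (wt p : ℝ)) (crossF (1 / 8) (-1) (QN (Nd + 1) 0 Δ)) +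
        (1 / 2 : ℝ) ^ (1 / 8 : ℝ) * (1 / 2 : ℝ) ^ (1 / 8 : ℝ) * (2 * absWeight Sl.toFinset (fun p => (wt p : ℝ))) *
          (tailMajorB Λ (Nd + 1) * (2 * headMajorB Λ (Nd + 1) + tailMajorB Λ (Nd + 1))) ≤
      -epsLowerMarginB Λ Nd (((a : ℝ) + L) / q) := by
  have hqR : (0 : ℝ) < q := by exact_mod_cast hq
  have hΔ : 0 ≤ Δ := le_trans (by positivity) hlo
  obtain ⟨hylo, hyhi⟩ := half_mem_cell hq hlo hhi
  have h := evalR_nonneg_of_bernAuto_trunc hq ha hL hchk (y := Δ / 2) hylo hyhi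
  rw [evalR_zadd] at h
  have hm1 : evalR (castZ [-1]) (Δ / 2) = -1 := by simp
  rw [hm1] at h
  -- atoms
  set Pv := evalR (castZ (cellPolyZ wt Sl Λ 0 Nd)) (Δ / 2) with hPv
  set DD := denProd Nd 0 (Δ / 2) * denProd Nd 0 (Δ / 2) with hDD
  set c1 : ℝ := ((epsC1B Λ Nd : ℕ) : ℝ) with hc1
  set Kr : ℝ := ((epsKZB wt Sl Λ Nd : ℤ) : ℝ) with hKr
  set c2 : ℝ := (1 / 2 : ℝ) ^ (1 / 8 : ℝ) * (1 / 2 : ℝ) ^ (1 / 8 : ℝ) with hc2def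
  set Wr := absWeight Sl.toFinset (fun p => (wt p : ℝ)) with hWr
  set X := (2 : ℝ) ^ Δ * taylorFunctional2D (1 / 2) Sl.toFinset (fun p => (wt p : ℝ)) (crossF (1 / 8) (-1) (QN (Nd + 1) 0 Δ)) with hX
  set Tr := c2 * (2 * Wr) * (tailMajorB Λ (Nd + 1) * (2 * headMajorB Λ (Nd + 1) + tailMajorB Λ (Nd + 1))) with hTr
  have hev : evalR (castZ (epsLowerPolyZB wt Sl Λ Nd)) (Δ / 2) = -c1 * Pv - Kr * DD := by
    rw [epsLowerPolyZB, evalR_zadd, evalR_zsmul, evalR_zsmul, evalR_zmul, evalR_dpolyZ, hc1, hKr, hPv, hDD]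
    push_cast
    ring
  rw [hev] at h
  -- positivity of the atoms
  have hc2pos : 0 < c2 := by
    have : (0 : ℝ) < (1 / 2 : ℝ) ^ (1 / 8 : ℝ) := Real.rpow_pos_of_pos (by norm_num) _
    rw [hc2def]; positivity
  have hD : 0 < denProd Nd 0 (Δ / 2) := denProd_pos Nd 0 (by push_cast; linarith)
  have hDm : denProd Nd 0 (Δ / 2) ≤ denProd Nd 0 (((a : ℝ) + L) / q) := denProd_zero_mono Nd (by linarith) hyhi
  have hc1pos : 0 < c1 := by rw [hc1]; exact_mod_cast epsC1B_pos hΛN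
  have hdpos : 0 < Nd + 1 + 2 - 2 * Λ := by omega
  have hdR : (((Nd + 1 + 2 - 2 * Λ : ℕ)) : ℝ) = (Nd : ℝ) + 3 - 2 * Λ := by
    rw [Nat.cast_sub (by omega)]; push_cast; ring
  have hd1R : (((Nd + 1 + 2 - Λ : ℕ)) : ℝ) = (Nd : ℝ) + 3 - Λ := by
    rw [Nat.cast_sub (by omega)]; push_cast; ring
  set M1 : ℝ := 8 ^ Λ * (Λ.factorial : ℝ) * (Λ.factorial : ℝ) * (4 : ℝ) ^ Nd * DD with hM1
  have hM1pos : 0 < M1 := by rw [hM1, hDD]; positivity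
  -- the block identity `M1 · X = c2 · P̂₀(y)`
  have hQ : M1 * X = c2 * Pv := by
    have hkey := two_rpow_mul_phiQ_eq wt hnd hΛ Nd hΔ
    rw [pow_two] at hkey
    rw [hM1, hDD, hX, hc2def, hPv]
    linear_combination hkey
  -- the tail identity `M1 · Tr · c1 = c2 · Kr · DD`
  have hW := cast_wabsZ wt hnd
  have hσ : tailMajorB Λ (Nd + 1) = ((epsAB Λ Nd : ℕ) : ℝ) / (2 ^ (Nd + 1) * (((Nd + 1 + 2 - 2 * Λ : ℕ)) : ℝ)) := by
    rw [tailMajorB, epsAB, bndBK_eq, hdR, one_div_pow, Nat.cast_mul, Nat.cast_mul, hd1R]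
    have hne : (Nd : ℝ) + 3 - 2 * Λ ≠ 0 := by rw [← hdR]; exact_mod_cast hdpos.ne'
    have e2 : ((Nd + 1 : ℕ) : ℝ) + 2 - 2 * Λ = (Nd : ℝ) + 3 - 2 * Λ := by push_cast; ring
    have e1 : ((Nd + 1 : ℕ) : ℝ) + 2 - Λ = (Nd : ℝ) + 3 - Λ := by push_cast; ring
    rw [e1, e2, eq_div_iff (mul_ne_zero (by positivity) hne)]
    field_simp
    push_cast
    ring
  have hH : headMajorB Λ (Nd + 1) = ((headMajorBK Λ (Nd + 1) (Nd + 1) : ℕ) : ℝ) / 2 ^ (Nd + 1) := by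
    rw [headMajorB_eq, headMajorBK_eq, headMajorBZ]
  have hT : M1 * Tr * c1 = c2 * Kr * DD := by
    rw [hTr, hσ, hH, hM1, hKr, hc1, hWr, ← hW, epsKZB, epsC1B]
    have hd0 : (((Nd + 1 + 2 - 2 * Λ : ℕ)) : ℝ) ≠ 0 := by exact_mod_cast hdpos.ne'
    have h4 : (4 : ℝ) ^ (Nd + 1) = 2 ^ (Nd + 1) * 2 ^ (Nd + 1) := by rw [← mul_pow]; norm_num
    push_cast
    rw [h4]
    field_simp
  -- `h : 0 ≤ -c1 Pv - Kr DD - 1` ⇒ `M1 (X + Tr) c1 = c2 (c1 Pv + Kr DD) ≤ -c2`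
  have hsum : M1 * (X + Tr) * c1 ≤ -c2 := by
    have h3 : c1 * Pv + Kr * DD ≤ -1 := by linarith
    have h4 : M1 * (X + Tr) * c1 = c2 * (c1 * Pv + Kr * DD) := by
      calc M1 * (X + Tr) * c1 = c1 * (M1 * X) + M1 * Tr * c1 := by ring
        _ = c1 * (c2 * Pv) + c2 * Kr * DD := by rw [hQ, hT]
        _ = c2 * (c1 * Pv + Kr * DD) := by ring
    rw [h4]
    have h5 := mul_le_mul_of_nonneg_left h3 hc2pos.le
    linarith
  have hle1 : X + Tr ≤ -c2 / (M1 * c1) := by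
    rw [le_div_iff₀ (mul_pos hM1pos hc1pos)]
    nlinarith [hsum]
  -- the margin at `Δ/2` dominates the one at the right end `y₂`
  have hmargin : epsLowerMarginB Λ Nd (((a : ℝ) + L) / q) ≤ c2 / (M1 * c1) := by
    unfold epsLowerMarginB
    rw [← hc2def, ← hc1, hM1, hDD]
    have hD2 : 0 < denProd Nd 0 (((a : ℝ) + L) / q) := lt_of_lt_of_le hD hDm
    rw [div_le_div_iff₀ (by positivity) (by positivity)]
    have hsq : denProd Nd 0 (Δ / 2) * denProd Nd 0 (Δ / 2) ≤ (denProd Nd 0 (((a : ℝ) + L) / q)) ^ 2 := by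
      rw [pow_two]; exact mul_le_mul hDm hDm hD.le hD2.le
    have hrest : 0 ≤ c2 * (8 ^ Λ * (Λ.factorial : ℝ) * (Λ.factorial : ℝ) * (4 : ℝ) ^ Nd * c1) := by positivity
    nlinarith [mul_le_mul_of_nonneg_left hsq hrest]
  have hneg : -c2 / (M1 * c1) = -(c2 / (M1 * c1)) := neg_div _ _
  rw [hneg] at hle1
  linarith

end Summit.CriticalPhenomena.Ising3D.Control2D
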